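import Literature.Geometry.Riemannian.LowEntropyHypersurfacesFourAssembly
import Literature.Geometry.Riemannian.SurgicalRicciFlowBridge
import Literature.Geometry.Riemannian.SurgicalRicciFlowProofs
import HarnessLib

/-!
# Low-entropy hypersurfaces of `ℝ⁵`, Cor. 1.5 (b) of Chodosh–Mantoulidis–Schulze 2025 for `n = 4`:
# the mean curvature flow with surgery as a structure, and the reduction of the named fact
# `ChodoshMantoulidisSchulze2025_cor15b_four` to it (and to Cerf's `Γ₄ = 0`)

Companion of `LowEntropyHypersurfacesFourAssembly.lean`, whose named fact
`Literature.Geometry.Riemannian.ChodoshMantoulidisSchulze2025_cor15b_four` renders Cor. 1.5 (b)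
(= Cor. 1.22 (b), unconditional for `n ≤ 5` by Remarks 1.16 and 1.17) of O. Chodosh,
C. Mantoulidis, F. Schulze, *Mean curvature flow with generic low-entropy initial data II*,
Duke Math. J. 174 (2025), arXiv:2309.03856, for `n = 4` and simply connected `M`:
a simply connected closed connected embedded hypersurface `ι : M⁴ ↪ ℝ⁵` with
`λ(ι(M)) ≤ λ(𝕊²(2) × ℝ²) = λ(𝕊²)` is diffeomorphic to the standard `𝕊⁴`.

## The printed proof and what this file proves of it

Proof of Cor. 1.22 (arXiv text, §1.6, p. 6): "either `M` is a round sphere (in which case we are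
done), or we can find a small `C^∞` graph `M'` over `M` so that `λ(M') < Λ` and so that there is
`ℳ' ∈ 𝔉(M')` with `sing_non-gen ℳ' = ∅` [Thm. 1.13]. … In case (b), we additionally use the
surgery of [Daniels-Holgate]" — i.e. (Cor. 1.5 (b), p. 3) "the mean curvature flow with surgery of
[Daniels-Holgate] (cf. [Huisken–Sinestrari], [Haslhofer–Kleiner]) provides a smooth isotopy from
`M` to the boundary of a standard handlebody that is either a standard ball or a boundary connect
sum of finitely many `B⁴ × 𝕊¹`'s". The topological mechanism is the one of Daniels-Holgate 2022,
§6 (Lemma 6.2 and the proof of Thm. 6.4, one dimension lower): a smooth mean curvature flow with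
surgery (Haslhofer–Kleiner, Def. 2.20/2.26 of loc. cit.: finitely many smooth flows; at each
surgery time finitely many necks `𝕊ⁿ⁻¹ × I` are replaced by pairs of standard caps (`n`-discs) and
the components of high curvature are discarded, each discarded component being diffeomorphic to
`𝕊ⁿ` or `𝕊ⁿ⁻¹ × 𝕊¹` — loc. cit. Thm. 2.29, from Haslhofer–Kleiner's canonical neighbourhood
theorem; the flow "vanishes in finite time", Thm. 1.3) is a smooth isotopy between surgery times,
and "the reversing of the surgery is a connected sum" (p. 21), so `M' ≅ M` is an iterated connected
sum of the discarded pieces and of handles `𝕊³ × 𝕊¹`; for simply connected `M` no handle and no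
`𝕊³ × 𝕊¹` occurs and `M ≅ 𝕊⁴`.

The tree cannot state Brakke flows, the class `𝔉(M)`, tangent flows or `δ`-necks, so neither
Thm. 1.13 of the cited paper nor Thm. 1.3 of Daniels-Holgate is statable as printed. But the
OUTCOME they are invoked for — a smooth mean curvature flow with finitely many surgeries from the
perturbed hypersurface, vanishing in finite time, with the printed topology of its surgeries and
discarded components — is statable over the tree's classical flows (`IsClassicalMCF`,
`MeanConvexLevelSetFlow.lean`) and the surgery vocabulary built for the Ricci flow with surgery
on 4-manifolds (`SurgicalRicciFlow.lean`: compact regular domains, collared neck / ball pieces,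
discarded closed pieces, `PresurgeryPieces`, `PostsurgeryPieces`, `IsUnionOfPieces`), exactly as
Chen–Zhu's Thm. 1.1 is rendered there (`ChenZhuResolvableIn`). This file:

* `IsMCFSurgeryStep F T ι'` — **one surgery time** of a mean curvature flow with surgery in `ℝ⁵`
  (Haslhofer–Kleiner Def. 2.20 (1)–(2) / Def. 2.26 (3) as recalled in Daniels-Holgate 2022, §2.1,
  with Thm. 2.29 for the discarded components), in the collared reading of `IsSurgeryStep`: the
  classical flow `F` on the closed 4-manifold `M` reaches the surgery time `T` smoothly; a compact
  regular domain `N ⊆ M` (the part kept) is identified, by a diffeomorphism `Φ` of open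
  neighbourhoods, with a compact regular domain `N'` of the post-surgery closed 4-manifold `M'`,
  whose embedding `ι' : M' ↪ ℝ⁵` AGREES with the time-`T` slice there (`ι' ∘ Φ = F T` near `N`:
  "the modification takes place inside a ball" around each neck, Def. 2.19); the components of
  `M ∖ N` are finitely many collared necks `𝕊³ × (0,1)` (a replaced neck together with the
  discarded region beyond it when that region carries a second surgery cap), collared balls (a
  neck followed by a discarded region diffeomorphic to a punctured sphere) or discarded closed
  components (convex components `≅ 𝕊⁴`, rings `≅ 𝕊³ × 𝕊¹`: Thm. 2.29), and the components of
  `M' ∖ N'` are finitely many collared balls (the surviving surgery caps: "of each pair of facing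
  surgery caps precisely one is discarded", Def. 2.26 (3)).
* `MCFSurgeryResolvableIn m M ι` — **`ι(M)` is resolved by a mean curvature flow with `m`
  surgery times** (recursion on `m`, each stage time-shifted to start at `0`): a classical mean
  curvature flow of embedded hypersurfaces `F` from `F 0 = ι` on `[0, T]`, `T > 0`, followed for
  `m = 0` by the discarding of everything ("`ℳ_ℍ` vanishes in finite time", Thm. 1.3: every
  component of `M` is then a discarded piece, `IsUnionOfPieces M`), and for `m + 1` by one
  surgery step to some `(M', ι')` resolved with `m` surgery times.
* `forall_component_isNeckSurgeryResolvable_of_mcfSurgeryResolvableIn` (**proved**, given Cerf's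
  theorem `Literature.Topology.FourManifolds.cerf_pi0Diff_sphere_three`): every simply connected
  component of a manifold resolved by a mean curvature flow with `m` surgeries is neck-surgery
  resolvable (`IsNeckSurgeryResolvable`, `HamiltonSurgeryProgramme.lean`) — the outer induction of
  `SurgicalRicciFlowBridge.lean` verbatim (the flows are forgotten; only the surgery topology is
  used: `exists_restrict_component`, `isNeckSurgeryResolvable_of_remainder`), i.e. Daniels-Holgate's
  "reversing of the surgery is a connected sum" made rigorous by the tree's neck-cutting /
  cap-absorption theory (where Cerf's `Γ₄ = 0` matches caps with necks).
* `MCFSurgeryResolvableIn.nonempty_diffeomorph_sphere` (**proved**, given Cerf): a simply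
  connected closed 4-manifold some embedding of which into `ℝ⁵` is resolved by a mean curvature
  flow with surgery is diffeomorphic to `𝕊⁴` (`IsNeckSurgeryResolvable.nonempty_diffeomorph_sphere`:
  connected sum of spheres, Kervaire–Milnor `𝕊⁴ # 𝕊⁴ ≅ 𝕊⁴`, all proved in the tree).
* `ChodoshMantoulidisSchulze2025_cor15b_four_of_perturbedSurgeryFlow_of_cerf` (**proved**): the
  named fact follows from Cerf's theorem and the displayed ANALYTIC statement `hflow` — for every
  closed connected embedded `ι : M⁴ ↪ ℝ⁵` with `λ(ι(M)) ≤ λ(𝕊²(2) × ℝ²)`, either `ι(M)` is a round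
  sphere, or for every `ε > 0` there is an embedding `ι₁` of `M`, `ε`-close to `ι` in `C⁰`, with
  `λ(ι₁(M)) < λ(𝕊²(2) × ℝ²)`, resolved by a mean curvature flow with finitely many surgeries —
  which is what Thm. 1.13 / Cor. 1.19 of the cited paper (the perturbation `M'`, a `C^∞`-small
  graph over `M`, hence an embedded copy of `M`; `λ(M') < Λ`; only multiplicity-one `𝕊⁴`- and
  `𝕊³ × ℝ`-type singularities below `λ(𝕊²)`, Rem. 1.9) and Daniels-Holgate 2022, Thm. 1.3 with
  Thm. 2.29, deliver in the printed proof; and its minimal form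
  `ChodoshMantoulidisSchulze2025_cor15b_four_of_mcfSurgery_of_cerf` (round, or some map of `M`
  into `ℝ⁵` is resolved by a flow with surgery). The round case is the tree's
  `nonempty_diffeomorph_sphere_four_of_range_eq_sphere`.
* Non-vacuity / consistency of the structure: the standard `𝕊⁴ ⊂ ℝ⁵` is resolved with no surgery
  by its homothetically shrinking flow (`mcfSurgeryResolvableIn_zero_unitSphere`, from
  `ShrinkingSphereMCF.lean` and `isUnionOfPieces_sphere`), and the time-`T` slice of any family is
  a (trivial) surgery of it (`isMCFSurgeryStep_self`).

No named fact is introduced (D-0026): the analytic statement `hflow` is an explicit hypothesis,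
as Chen–Zhu's Thm. 1.1 is in `SurgicalRicciFlowBridge.lean`. So the trust base of
`ChodoshMantoulidisSchulze2025_cor15b_four` is reduced to that statement (Chodosh–Mantoulidis–
Schulze 2025, Thm. 1.13, and Daniels-Holgate 2022, Thm. 1.3 / Thm. 2.29, whose proofs are the
Brakke-flow analysis the tree lacks) and Cerf 1968, Théorème 1.

## References

* [ChodoshMantoulidisSchulze2025] O. Chodosh, C. Mantoulidis, F. Schulze, *Mean curvature flow
  with generic low-entropy initial data II*, Duke Math. J. 174 (2025), arXiv:2309.03856: Cor. 1.5
  (p. 3), Rem. 1.9, Thm. 1.13, Rem. 1.16, Rem. 1.17, Cor. 1.19, Cor. 1.22 and its proof (§1.6, p. 6).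
* [DanielsHolgate2022] J. M. Daniels-Holgate, *Approximation of mean curvature flow with generic
  singularities by smooth flows with surgery*, Adv. Math. 410 (2022) 108715, arXiv:2104.11647:
  Thm. 1.3, §2.1 (Def. 2.19, Def. 2.20, Def. 2.26, Thm. 2.27, Thm. 2.29), §6 (Lemma 6.2, Thm. 6.4
  and its proof, pp. 20–21).
* [Hamilton1997] R. S. Hamilton, Comm. Anal. Geom. 5 (1997), §1.1 pp. 3–4 (the surgery programme).
* [CerfDiffeoSphere1968] J. Cerf, *Sur les difféomorphismes de la sphère de dimension trois
  (Γ₄ = 0)*, LNM 53 (1968), Ch. I §1, Théorème 1.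
-/

noncomputable section

open Set Function Metric TopologicalSpace Filter
open scoped Manifold ContDiff Topology

namespace Literature.Geometry.Riemannian

open Literature.Topology.FourManifolds Lorentzian

/-- Local notation: `𝔼 n` is the model Euclidean space `EuclideanSpace ℝ (Fin n)`. -/
local notation "𝔼 " n:arg => EuclideanSpace ℝ (Fin n)

/-! ### One surgery time, and resolution by a flow with finitely many surgeries -/

section Surgery

/-- **`(M', ι')` is obtained from the classical flow `F` on `M × [0, T]` by one surgery at time
`T`** — one surgery time of a mean curvature flow with surgery in `ℝ⁵` (Haslhofer–Kleiner's
`(α, δ)`-flows, Def. 2.20 (1)–(2) and Def. 2.26 (3) as recalled in [DanielsHolgate2022, §2.1], with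
the discarded components of Thm. 2.29), rendered topologically in the collared reading of
`IsSurgeryStep` (`SurgicalRicciFlow.lean`): there are compact regular domains `N ⊆ M` (the part of
the time-`T` slice that is kept) and `N' ⊆ M'`, open `U ⊇ N`, `U' ⊇ N'` and mutually inverse
`C^∞` maps `Φ : U → U'`, `Ψ : U' → U` with `Φ(N) = N'`, such that the new embedded hypersurface
agrees with the old slice on the kept part, `ι' (Φ x) = F T x` for `x ∈ U` ("the modification
takes place inside a ball" about each neck, Def. 2.19), the components of `M ∖ N` are finitely
many collared necks `𝕊³ × (0,1)`, collared balls, (collared projective caps — vacuous for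
hypersurfaces of `ℝ⁵`, kept only to reuse the predicate) or discarded closed pieces
(`PresurgeryPieces`: the replaced necks together with the discarded high-curvature regions beyond
them, and the discarded closed components `≅ 𝕊⁴`, `𝕊³ × 𝕊¹` of Thm. 2.29), and the components of
`M' ∖ N'` are finitely many collared balls (`PostsurgeryPieces`: the surviving standard caps, "of
each pair of facing surgery caps precisely one is discarded", Def. 2.26 (3)).
[cite: DanielsHolgate2022, §2.1, Def. 2.19, Def. 2.20, Def. 2.26 and Thm. 2.29] -/
def IsMCFSurgeryStep {M : Type} [TopologicalSpace M] [ChartedSpace (𝔼 4) M]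
    {M' : Type} [TopologicalSpace M'] [ChartedSpace (𝔼 4) M']
    (F : ℝ → M → 𝔼 5) (T : ℝ) (ι' : M' → 𝔼 5) : Prop :=
  ∃ (N U : Set M) (N' U' : Set M') (Φ : M → M') (Ψ : M' → M),
    IsCompactRegularDomain (𝓡 4) N ∧ IsCompactRegularDomain (𝓡 4) N' ∧
    IsOpen U ∧ N ⊆ U ∧ IsOpen U' ∧ N' ⊆ U' ∧
    ContMDiffOn (𝓡 4) (𝓡 4) ∞ Φ U ∧ ContMDiffOn (𝓡 4) (𝓡 4) ∞ Ψ U' ∧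
    MapsTo Φ U U' ∧ MapsTo Ψ U' U ∧
    (∀ x ∈ U, Ψ (Φ x) = x) ∧ (∀ y ∈ U', Φ (Ψ y) = y) ∧ Φ '' N = N' ∧
    (∀ x ∈ U, ι' (Φ x) = F T x) ∧
    PresurgeryPieces N ∧ PostsurgeryPieces N'

/-- **`ι(M) ⊂ ℝ⁵` is resolved by a mean curvature flow with `m` surgery times** — the structure
of a smooth mean curvature flow with surgery from the closed embedded hypersurface `ι(M)` that
vanishes in finite time ([DanielsHolgate2022, Thm. 1.3]: "`ℳ_ℍ` is a smooth mean curvature flow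
with surgery … `ℳ_ℍ` vanishes in finite time"; Haslhofer–Kleiner's Def. 2.20 / 2.26 and Thm. 2.29
loc. cit. §2.1), by recursion on `m`, each stage time-shifted to start at `t = 0`:
* `m = 0`: a classical mean curvature flow of embedded hypersurfaces `F` (`IsClassicalMCF` for
  the Euclidean metric of `ℝ⁵`) with `F 0 = ι` on `[0, T]`, `T > 0`, after which everything is
  discarded: every component of `M` is a discarded piece (`IsUnionOfPieces M`, i.e. finitely many
  components, each an iterated connected sum of `𝕊⁴`, `ℝℙ⁴`, `𝕊³ × 𝕊¹`, `𝕊³ ×~ 𝕊¹` — weaker than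
  the printed "`𝕊ⁿ` or `𝕊ⁿ⁻¹ × 𝕊¹`" of Thm. 2.29, as befits a conclusion);
* `m + 1`: such a flow `F` on `[0, T]`, `T > 0`, and a closed 4-manifold `M'` (compact,
  Hausdorff, second countable, `C^∞`, possibly disconnected or empty) with a `C^∞` embedding
  `ι' : M' → ℝ⁵` obtained from `F` by one surgery at time `T` (`IsMCFSurgeryStep`) such that
  `ι'(M')` is resolved with `m` surgery times.
[cite: DanielsHolgate2022, Thm. 1.3, §2.1 Def. 2.20, Def. 2.26, Thm. 2.29] -/
def MCFSurgeryResolvableIn : ℕ → ∀ (M : Type) [TopologicalSpace M] [T2Space M]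
    [SecondCountableTopology M] [CompactSpace M] [ChartedSpace (𝔼 4) M] [IsManifold (𝓡 4) ∞ M],
    (M → 𝔼 5) → Prop
  | 0, M, _, _, _, _, _, _, ι =>
      ∃ (F : ℝ → M → 𝔼 5) (ν : (t : ℝ) → Lorentzian.NormalField (𝓡 5) (F t)) (T : ℝ),
        0 < T ∧ IsClassicalMCF (euclideanMetric (𝔼 5)) F ν 0 T ∧ F 0 = ι ∧ IsUnionOfPieces M
  | m + 1, M, _, _, _, _, _, _, ι =>
      ∃ (F : ℝ → M → 𝔼 5) (ν : (t : ℝ) → Lorentzian.NormalField (𝓡 5) (F t)) (T : ℝ),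
        0 < T ∧ IsClassicalMCF (euclideanMetric (𝔼 5)) F ν 0 T ∧ F 0 = ι ∧
        ∃ (M' : Type) (_ : TopologicalSpace M') (_ : T2Space M') (_ : SecondCountableTopology M')
          (_ : CompactSpace M') (_ : ChartedSpace (𝔼 4) M') (_ : IsManifold (𝓡 4) ∞ M')
          (ι' : M' → 𝔼 5), Manifold.IsSmoothEmbedding (𝓡 4) (𝓡 5) ∞ ι' ∧
          IsMCFSurgeryStep F T ι' ∧ MCFSurgeryResolvableIn m M' ι'

variable {M : Type} [TopologicalSpace M] [T2Space M] [SecondCountableTopology M] [CompactSpace M]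
  [ChartedSpace (𝔼 4) M] [IsManifold (𝓡 4) ∞ M]

/-- Unfolding the base case. [folklore] -/
theorem mcfSurgeryResolvableIn_zero_iff (ι : M → 𝔼 5) :
    MCFSurgeryResolvableIn 0 M ι ↔
      ∃ (F : ℝ → M → 𝔼 5) (ν : (t : ℝ) → Lorentzian.NormalField (𝓡 5) (F t)) (T : ℝ),
        0 < T ∧ IsClassicalMCF (euclideanMetric (𝔼 5)) F ν 0 T ∧ F 0 = ι ∧ IsUnionOfPieces M :=
  Iff.rfl

/-- Unfolding the successor case. [folklore] -/
theorem mcfSurgeryResolvableIn_succ_iff (m : ℕ) (ι : M → 𝔼 5) :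
    MCFSurgeryResolvableIn (m + 1) M ι ↔
      ∃ (F : ℝ → M → 𝔼 5) (ν : (t : ℝ) → Lorentzian.NormalField (𝓡 5) (F t)) (T : ℝ),
        0 < T ∧ IsClassicalMCF (euclideanMetric (𝔼 5)) F ν 0 T ∧ F 0 = ι ∧
        ∃ (M' : Type) (_ : TopologicalSpace M') (_ : T2Space M') (_ : SecondCountableTopology M')
          (_ : CompactSpace M') (_ : ChartedSpace (𝔼 4) M') (_ : IsManifold (𝓡 4) ∞ M')
          (ι' : M' → 𝔼 5), Manifold.IsSmoothEmbedding (𝓡 4) (𝓡 5) ∞ ι' ∧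
          IsMCFSurgeryStep F T ι' ∧ MCFSurgeryResolvableIn m M' ι' :=
  Iff.rfl

/-- In every case the first stage is a classical mean curvature flow of embedded hypersurfaces
from `ι` on some `[0, T]`, `T > 0` (between surgery times "the flow `ℳ_ℍ` is a smooth flow with
surgery, and thus a mean curvature flow", [DanielsHolgate2022, Lemma 6.2 (i)]).
[cite: DanielsHolgate2022, Lemma 6.2 (i)] -/
theorem MCFSurgeryResolvableIn.exists_isClassicalMCF {m : ℕ} {ι : M → 𝔼 5}
    (h : MCFSurgeryResolvableIn m M ι) :
    ∃ (F : ℝ → M → 𝔼 5) (ν : (t : ℝ) → Lorentzian.NormalField (𝓡 5) (F t)) (T : ℝ),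
      0 < T ∧ IsClassicalMCF (euclideanMetric (𝔼 5)) F ν 0 T ∧ F 0 = ι := by
  cases m with
  | zero =>
    obtain ⟨F, ν, T, hT, hF, h0, -⟩ := h
    exact ⟨F, ν, T, hT, hF, h0⟩
  | succ m =>
    obtain ⟨F, ν, T, hT, hF, h0, -⟩ := h
    exact ⟨F, ν, T, hT, hF, h0⟩

/-- The initial map of a resolvable pair is injective (it is the time-`0` slice of a classical
flow of embedded hypersurfaces). [folklore] -/
theorem MCFSurgeryResolvableIn.injective {m : ℕ} {ι : M → 𝔼 5}
    (h : MCFSurgeryResolvableIn m M ι) : Injective ι := by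
  obtain ⟨F, ν, T, hT, hF, h0⟩ := h.exists_isClassicalMCF
  rw [← h0]
  exact hF.injective 0 ⟨le_rfl, hT.le⟩

omit [T2Space M] [SecondCountableTopology M] [IsManifold (𝓡 4) ∞ M] in
/-- **The trivial surgery** (consistency of the relation): the time-`T` slice `F T : M → ℝ⁵` of
any family is obtained from `F` by a surgery step at time `T` with nothing cut — `M' = M`,
`N = N' = M`, `Φ = Ψ = id`, no pieces. [folklore] -/
theorem isMCFSurgeryStep_self (F : ℝ → M → 𝔼 5) (T : ℝ) : IsMCFSurgeryStep F T (F T) := by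
  refine ⟨univ, univ, univ, univ, id, id, isCompactRegularDomain_univ _ _,
    isCompactRegularDomain_univ _ _, isOpen_univ, subset_univ _, isOpen_univ, subset_univ _,
    contMDiff_id.contMDiffOn, contMDiff_id.contMDiffOn, mapsTo_univ _ _, mapsTo_univ _ _,
    fun _ _ ↦ rfl, fun _ _ ↦ rfl, image_id _, fun _ _ ↦ rfl, ?_, ?_⟩
  · simp [PresurgeryPieces]
  · simp [PostsurgeryPieces]

end Surgery

/-! ### Non-vacuity: the round sphere is resolved with no surgery -/

section Round

/-- **The standard `𝕊⁴ ⊂ ℝ⁵` is resolved by the mean curvature flow with no surgery**: the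
inclusion is the time-`0` slice of the homothetically shrinking flow `c ↦ √(1 - 8t) · y` about
`0` with extinction time `1/8` (`ShrinkingSphereMCF.lean`, a classical flow on `[0, 1/16]`), and
`𝕊⁴` is a single (discarded) piece (`isUnionOfPieces_sphere`) — the example "the shrinking sphere
that vanishes once the mean curvature reaches `H_th` is a weak `(α, δ, ℍ)`-surgery flow" of
[DanielsHolgate2022, Example 3.21] (Def. 3.11, Def. 3.17). [cite: DanielsHolgate2022, §3, Example 3.21] -/
theorem mcfSurgeryResolvableIn_zero_unitSphere :
    MCFSurgeryResolvableIn 0 (Metric.sphere (0 : 𝔼 5) 1)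
      (Subtype.val : Metric.sphere (0 : 𝔼 5) 1 → 𝔼 5) := by
  refine ⟨shrinkingSphereFlowAt 4 0 (1 / 8), shrinkingSphereNormalAt 4 0 (1 / 8), 1 / 16,
    by norm_num, isClassicalMCF_shrinkingSphereAt (by norm_num) 0 _ (by norm_num), ?_,
    isUnionOfPieces_sphere⟩
  funext y
  simp only [shrinkingSphereFlowAt, shrinkingSphereRadius, zero_add, sub_zero]
  norm_num

end Round

/-! ### The outer induction over the surgeries -/

section Outer

/-- **Every simply connected component of a closed 4-manifold resolved by a mean curvature flow
with `m` surgeries is neck-surgery resolvable** (given Cerf's theorem) — Daniels-Holgate's "the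
reversing of the surgery is a connected sum of spheres … No handles will be introduced" (proof of
Thm. 6.4, p. 21; Lemma 6.2 (ii)) in the rigorous form of the tree's surgery topology. Induction on
`m` in `MCFSurgeryResolvableIn m M ι`, the flows being forgotten: for `m = 0`, `M` is a finite
union of pieces and every component is an iterated connected sum of Hamilton's pieces
(`IsUnionOfPieces.exists_isNeckSurgeryResolvable_component`); for `m + 1`, the surgery step to
`M'` is restricted to the component `X` (`exists_restrict_component`): `X` is a discarded piece
(resolvable), or contains a projective cap (impossible, `X` being simply connected), or carries
surgery data with neck and ball pieces, and then `isNeckSurgeryResolvable_of_remainder`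
(`SurgicalRicciFlowBridge.lean`: cut the necks, absorb the caps by Cerf's `Γ₄ = 0`) applies with
the induction hypothesis for `M'`. [cite: DanielsHolgate2022, Lemma 6.2 and proof of Thm. 6.4 (pp. 20–21)]
[cite: Hamilton1997, §1.1 pp. 3–4] -/
theorem forall_component_isNeckSurgeryResolvable_of_mcfSurgeryResolvableIn
    (hcerf : cerf_pi0Diff_sphere_three) (m : ℕ) :
    ∀ (M : Type) [TopologicalSpace M] [T2Space M] [SecondCountableTopology M] [CompactSpace M]
      [ChartedSpace (𝔼 4) M] [IsManifold (𝓡 4) ∞ M] (ι : M → 𝔼 5),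
      MCFSurgeryResolvableIn m M ι →
      ∀ X : Opens M, (∃ x, (X : Set M) = connectedComponent x) → SimplyConnectedSpace X →
        IsNeckSurgeryResolvable X := by
  induction m with
  | zero =>
    intro M _ _ _ _ _ _ ι h X hX hXsc
    rw [mcfSurgeryResolvableIn_zero_iff] at h
    obtain ⟨-, -, -, -, -, -, hpieces⟩ := h
    obtain ⟨x, hx⟩ := hX
    obtain ⟨C, hC, hres⟩ := hpieces.exists_isNeckSurgeryResolvable_component x
    have : C = X := Opens.ext (hC.trans hx.symm)
    exact this ▸ hres
  | succ m ih =>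
    intro M _ _ _ _ _ _ ι h X hX hXsc
    rw [mcfSurgeryResolvableIn_succ_iff] at h
    obtain ⟨F, ν, T, -, -, -, M', i₁, i₂, i₃, i₄, i₅, i₆, ι', -, hstep, hres'⟩ := h
    obtain ⟨N, U, N', U', Φ, Ψ, hNreg, hN'reg, hU, hNU, hU', hN'U', hΦc, hΨc, hΦ, hΨ, hleft,
      hright, hΦN, -, hpre, hpost⟩ := hstep
    haveI : LocallyConnectedSpace M' := ChartedSpace.locallyConnectedSpace (𝔼 4) M'
    have hN : IsClosed N := hNreg.isClosed
    have hN' : IsClosed N' := hN'reg.isClosed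
    have hΦN' : Φ '' N = N' ∩ U' := by rw [hΦN, inter_eq_left.2 hN'U']
    have hfr : ∀ C' ∈ componentsOf N'ᶜ, frontier C' ⊆ U' ∨ Disjoint (frontier C') U' := by
      intro C' hC'
      left
      rw [(isOpen_of_mem_componentsOf hN'.isOpen_compl hC').frontier_eq]
      exact (IsBallPiece.closure_diff_subset (hpost.2 C' hC')
        (disjoint_of_mem_componentsOf_compl hC')).trans hN'U'
    -- the component `X`
    obtain ⟨x, hx⟩ := hX
    have hXc : IsClosed (X : Set M) := hx ▸ isClosed_connectedComponent
    have hXp : IsPreconnected (X : Set M) := hx ▸ isPreconnected_connectedComponent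
    haveI : Nonempty X := ⟨⟨x, show x ∈ (X : Set M) from hx ▸ mem_connectedComponent⟩⟩
    haveI : CompactSpace X := isCompact_iff_compactSpace.1 hXc.isCompact
    rcases exists_restrict_component hN hN' hU hNU hU' hΦc hΨc hΦ hΨ hleft hright hΦN' hpre.1
      hpre.2 hpost.2 hfr X hXc hXp with hd | hnsc | hdata
    · exact .of_isConnectedSumOf_isHamiltonPICPiece hd.2
    · exact absurd hXsc hnsc
    · obtain ⟨N₁, U₁, U₁', Φ₁, Ψ₁, hN₁, hU₁, hNU₁, hU₁', hΦ₁c, hΨ₁c, hm₁, hm₁', hl₁, hr₁, him₁,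
        hfin₁, hp₁, hfr₁⟩ := hdata
      exact isNeckSurgeryResolvable_of_remainder hcerf hN' hpost.1 hpost.2
        (fun Y hY hYsc => ih M' ι' hres' Y hY hYsc) _ X N₁ U₁ U₁' Φ₁ Ψ₁ hN₁ hU₁ hNU₁ hU₁' hΦ₁c
        hΨ₁c hm₁ hm₁' hl₁ hr₁ him₁ hfin₁ hp₁ le_rfl hfr₁

/-- **A simply connected closed 4-manifold resolved by a mean curvature flow with surgery is
neck-surgery resolvable** (given Cerf's theorem): apply the previous theorem to the single
component of `M`. [cite: DanielsHolgate2022, Lemma 6.2 and proof of Thm. 6.4 (pp. 20–21)] -/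
theorem MCFSurgeryResolvableIn.isNeckSurgeryResolvable (hcerf : cerf_pi0Diff_sphere_three)
    {m : ℕ} {M : Type} [TopologicalSpace M] [T2Space M] [SecondCountableTopology M]
    [CompactSpace M] [ChartedSpace (𝔼 4) M] [IsManifold (𝓡 4) ∞ M] {ι : M → 𝔼 5}
    (h : MCFSurgeryResolvableIn m M ι) (hsc : SimplyConnectedSpace M) :
    IsNeckSurgeryResolvable M := by
  haveI := hsc
  haveI : PathConnectedSpace M := inferInstance
  obtain ⟨x⟩ := (inferInstance : Nonempty M)
  have htop : ((⊤ : Opens M) : Set M) = univ := rfl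
  obtain ⟨e⟩ := nonempty_diffeomorph_opens_of_coe_eq_univ (I := 𝓡 4) (⊤ : Opens M) htop
  have hsc' : SimplyConnectedSpace (⊤ : Opens M) :=
    (e.toHomeomorph.toHomotopyEquiv.simplyConnectedSpace_iff).1 inferInstance
  have hres := forall_component_isNeckSurgeryResolvable_of_mcfSurgeryResolvableIn hcerf m M ι h ⊤
    ⟨x, by rw [htop, PreconnectedSpace.connectedComponent_eq_univ]⟩ hsc'
  exact hres.of_diffeomorph e.symm

/-- **A simply connected closed 4-manifold, some embedding of which into `ℝ⁵` is resolved by a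
mean curvature flow with surgery, is diffeomorphic to `𝕊⁴`** (given Cerf's theorem): it is
neck-surgery resolvable, hence a connected sum of copies of `𝕊⁴`
(`IsNeckSurgeryResolvable.nonempty_diffeomorph_sphere`, with Kervaire–Milnor's `𝕊⁴ # 𝕊⁴ ≅ 𝕊⁴`) —
for simply connected `M` "all dropped components are … spheres and no handles are broken", so
the reversed surgery "is a connected sum of spheres" ([DanielsHolgate2022, proof of Thm. 6.4]).
[cite: DanielsHolgate2022, proof of Thm. 6.4 (pp. 20–21)] [cite: ChodoshMantoulidisSchulze2025, Cor. 1.5 (b)] -/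
theorem MCFSurgeryResolvableIn.nonempty_diffeomorph_sphere (hcerf : cerf_pi0Diff_sphere_three)
    {m : ℕ} {M : Type} [TopologicalSpace M] [T2Space M] [SecondCountableTopology M]
    [CompactSpace M] [ChartedSpace (𝔼 4) M] [IsManifold (𝓡 4) ∞ M] {ι : M → 𝔼 5}
    (h : MCFSurgeryResolvableIn m M ι) (hsc : SimplyConnectedSpace M) :
    Nonempty (M ≃ₘ⟮𝓡 4, 𝓡 4⟯ (Metric.sphere (0 : 𝔼 5) 1)) :=
  (h.isNeckSurgeryResolvable hcerf hsc).nonempty_diffeomorph_sphere hsc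

end Outer

/-! ### The reduction of Cor. 1.5 (b), `n = 4`, to the flow with surgery and Cerf's theorem -/

section Reduction

/-- **Cor. 1.5 (b) / Cor. 1.22 (b) for `n = 4` (simply connected case) from the mean curvature
flow with surgery and Cerf's `Γ₄ = 0` — minimal form.** If every closed connected embedded
`ι : M⁴ ↪ ℝ⁵` with `λ(ι(M)) ≤ λ(𝕊²(2) × ℝ²)` either has image a round sphere or admits SOME map
`ι₁ : M → ℝ⁵` resolved by a mean curvature flow with finitely many surgeries
(`MCFSurgeryResolvableIn m M ι₁`), then the named fact
`ChodoshMantoulidisSchulze2025_cor15b_four` holds: in the round case by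
`nonempty_diffeomorph_sphere_four_of_range_eq_sphere` ("either `M` is a round sphere, in which
case we are done", proof of Cor. 1.22, p. 6), otherwise by
`MCFSurgeryResolvableIn.nonempty_diffeomorph_sphere` (for simply connected `M` "all dropped
components are … spheres and no handles are broken", [DanielsHolgate2022, proof of Thm. 6.4]). The
printed form of the hypothesis — the perturbation of Thm. 1.13 followed by Daniels-Holgate's flow
with surgery — implies this one (`…_of_perturbedSurgeryFlow_of_cerf` below).
[cite: ChodoshMantoulidisSchulze2025, Cor. 1.5 (b), Cor. 1.22 (b) and proof (§1.6, p. 6)]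
[cite: DanielsHolgate2022, Thm. 1.3, Lemma 6.2, proof of Thm. 6.4]
[cite: CerfDiffeoSphere1968, Ch. I §1, Théorème 1] -/
theorem ChodoshMantoulidisSchulze2025_cor15b_four_of_mcfSurgery_of_cerf
    (hflow : ∀ (M : Type) [TopologicalSpace M] [T2Space M] [SecondCountableTopology M]
      [CompactSpace M] [ConnectedSpace M] [ChartedSpace (𝔼 4) M] [IsManifold (𝓡 4) ∞ M]
      (ι : M → 𝔼 5), Manifold.IsSmoothEmbedding (𝓡 4) (𝓡 5) ∞ ι →
      gaussianEntropy 4 (range ι) ≤ gaussianEntropy 4 (shrinkingCylinder 4 2) →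
      (∃ (c : 𝔼 5) (r : ℝ), 0 < r ∧ range ι = Metric.sphere c r) ∨
      ∃ (ι₁ : M → 𝔼 5) (m : ℕ), MCFSurgeryResolvableIn m M ι₁)
    (hcerf : cerf_pi0Diff_sphere_three) :
    ChodoshMantoulidisSchulze2025_cor15b_four := by
  intro M _ _ _ _ _ _ _ hsc ι hι hent
  rcases hflow M ι hι hent with ⟨c, r, hr, hrange⟩ | ⟨ι₁, m, hres⟩
  · exact nonempty_diffeomorph_sphere_four_of_range_eq_sphere M hι hr hrange
  · exact hres.nonempty_diffeomorph_sphere hcerf hsc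

/-- **Cor. 1.5 (b) / Cor. 1.22 (b) for `n = 4` (simply connected case) from the printed analytic
input and Cerf's `Γ₄ = 0`.** The hypothesis `hflow` displays, in the tree's vocabulary, what the
printed proof (p. 6) obtains before any topology: for a closed connected embedded `ι : M⁴ ↪ ℝ⁵`
with `λ(ι(M)) ≤ λ(𝕊²(2) × ℝ²)` (`= λ(𝕊²)`), "either `M` is a round sphere (in which case we are
done), or we can find a small `C^∞` graph `M'` over `M` so that `λ(M') < Λ`" whose flow has
`sing_non-gen = ∅` [Thm. 1.13 / Cor. 1.19], hence — `λ < λ(𝕊²)` leaving only multiplicity-one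
`𝕊⁴`- and `𝕊³ × ℝ`-type singularities (Rem. 1.9) — admits "the mean curvature flow with surgery
of [Daniels-Holgate]" ([DanielsHolgate2022, Thm. 1.3], vanishing in finite time, with the
surgeries and discarded components of Haslhofer–Kleiner, loc. cit. Thm. 2.29): rendered as —
either `range ι` is a round sphere, or for every `ε > 0` there is a `C^∞` embedding
`ι₁ : M → ℝ⁵` (the graph `M'`, an embedded copy of `M`) with `‖ι₁ x - ι x‖ ≤ ε` for all `x`,
`λ(ι₁(M)) < λ(𝕊²(2) × ℝ²)`, and `MCFSurgeryResolvableIn m M ι₁` for some `m`. Conclusion: the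
named fact `ChodoshMantoulidisSchulze2025_cor15b_four`, by the minimal form above. The hypothesis
is not a named fact of the tree (D-0026); its proof is the Brakke-flow analysis of the two cited
papers, absent from Mathlib and the tree.
[cite: ChodoshMantoulidisSchulze2025, Cor. 1.5 (b), Cor. 1.22 (b) and proof (§1.6, p. 6), Thm. 1.13, Cor. 1.19, Rem. 1.9]
[cite: DanielsHolgate2022, Thm. 1.3, Thm. 2.29, Lemma 6.2, proof of Thm. 6.4]
[cite: CerfDiffeoSphere1968, Ch. I §1, Théorème 1] -/
theorem ChodoshMantoulidisSchulze2025_cor15b_four_of_perturbedSurgeryFlow_of_cerf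
    (hflow : ∀ (M : Type) [TopologicalSpace M] [T2Space M] [SecondCountableTopology M]
      [CompactSpace M] [ConnectedSpace M] [ChartedSpace (𝔼 4) M] [IsManifold (𝓡 4) ∞ M]
      (ι : M → 𝔼 5), Manifold.IsSmoothEmbedding (𝓡 4) (𝓡 5) ∞ ι →
      gaussianEntropy 4 (range ι) ≤ gaussianEntropy 4 (shrinkingCylinder 4 2) →
      (∃ (c : 𝔼 5) (r : ℝ), 0 < r ∧ range ι = Metric.sphere c r) ∨
      ∀ ε : ℝ, 0 < ε → ∃ ι₁ : M → 𝔼 5, Manifold.IsSmoothEmbedding (𝓡 4) (𝓡 5) ∞ ι₁ ∧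
        (∀ x, ‖ι₁ x - ι x‖ ≤ ε) ∧
        gaussianEntropy 4 (range ι₁) < gaussianEntropy 4 (shrinkingCylinder 4 2) ∧
        ∃ m : ℕ, MCFSurgeryResolvableIn m M ι₁)
    (hcerf : cerf_pi0Diff_sphere_three) :
    ChodoshMantoulidisSchulze2025_cor15b_four := by
  refine ChodoshMantoulidisSchulze2025_cor15b_four_of_mcfSurgery_of_cerf
    (fun M _ _ _ _ _ _ _ ι hι hent ↦ ?_) hcerf
  rcases hflow M ι hι hent with hround | hpert
  · exact Or.inl hround
  · obtain ⟨ι₁, -, -, -, m, hres⟩ := hpert 1 one_pos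
    exact Or.inr ⟨ι₁, m, hres⟩

end Reduction

end Literature.Geometry.Riemannian

end
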